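import Summits.RiemannHypothesis.RiemannHypothesis.Theorems.SoloInformedQuasiWeilDipole

/-!
# Exponential slack in Weil's criterion, IV: cells, tilts and the `σ`-direction

Solo programme `solo-RiemannHypothesis-informed`, session 2 — part of the exact-thermometer
package; the overview, the main theorem `width_iff_weilQuadratic_sobolev_subexp` and the
references are in `SoloInformedQuasiWeil.lean`. Everything here is proved (no named facts).

Real-variable tools for the upper half of the thermometer: Gallagher's unit cell
(`norm_sq_le_integral_cell`), weighted sampling of `ĝ` on the critical line under a bounded
local count (`sum_mul_norm_sq_weilMellin_line_le_of_localCount`, Plancherel), real exponential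
tilts `ĝ(s + σ) = (g e^{σx})^(s)` and a one-sided Sobolev cell in `σ` inside the strip
(`norm_sq_weilMellin_le_integral_sigma`).
-/

noncomputable section

open Complex Filter Set MeasureTheory
open scoped Real Topology ComplexConjugate ArithmeticFunction.vonMangoldt

namespace Summit.RiemannHypothesis.RiemannHypothesis.Theorems

open Literature.NumberTheory.LFunctions Literature.NumberTheory.LFunctions.WeilConverse

open intervalIntegral

variable {g : ℝ → ℂ}

/-! ### A unit-cell Sobolev bound -/

/-- `‖f x‖² ≤ ∫_{x-1/2}^{x+1/2} (3/2 ‖f‖² + 1/2 ‖f'‖²)` for `f` with continuous derivative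
(Gallagher's inequality on a unit cell and `|f||f'| ≤ (|f|² + |f'|²)/2`). [folklore] -/
theorem norm_sq_le_integral_cell {f f' : ℝ → ℂ} (hf : ∀ x, HasDerivAt f (f' x) x)
    (hf'c : Continuous f') (x : ℝ) :
    ‖f x‖ ^ 2 ≤ ∫ y in (x - 1 / 2)..(x + 1 / 2), (3 / 2 * ‖f y‖ ^ 2 + 1 / 2 * ‖f' y‖ ^ 2) := by
  have hfc : Continuous f := continuous_iff_continuousAt.2 fun x ↦ (hf x).continuousAt
  have h := Gallagher.norm_sq_le_of_hasDerivAt hf hf'c x one_pos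
  rw [inv_one, one_mul] at h
  have hle : x - 1 / 2 ≤ x + 1 / 2 := by linarith
  have hi1 : IntervalIntegrable (fun y ↦ ‖f y‖ ^ 2) volume (x - 1 / 2) (x + 1 / 2) :=
    (hfc.norm.pow 2).intervalIntegrable _ _
  have hi2 : IntervalIntegrable (fun y ↦ ‖f y‖ * ‖f' y‖) volume (x - 1 / 2) (x + 1 / 2) :=
    (hfc.norm.mul hf'c.norm).intervalIntegrable _ _
  have hi3 : IntervalIntegrable (fun y ↦ 3 / 2 * ‖f y‖ ^ 2 + 1 / 2 * ‖f' y‖ ^ 2) volume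
      (x - 1 / 2) (x + 1 / 2) :=
    ((continuous_const.mul (hfc.norm.pow 2)).add (continuous_const.mul (hf'c.norm.pow 2))).intervalIntegrable _ _
  calc ‖f x‖ ^ 2 ≤ (∫ y in (x - 1 / 2)..(x + 1 / 2), ‖f y‖ ^ 2) +
        ∫ y in (x - 1 / 2)..(x + 1 / 2), ‖f y‖ * ‖f' y‖ := h
    _ = ∫ y in (x - 1 / 2)..(x + 1 / 2), (‖f y‖ ^ 2 + ‖f y‖ * ‖f' y‖) :=
        (intervalIntegral.integral_add hi1 hi2).symm
    _ ≤ ∫ y in (x - 1 / 2)..(x + 1 / 2), (3 / 2 * ‖f y‖ ^ 2 + 1 / 2 * ‖f' y‖ ^ 2) := by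
        refine intervalIntegral.integral_mono_on hle (hi1.add hi2) hi3 fun y _ ↦ ?_
        nlinarith [sq_nonneg (‖f y‖ - ‖f' y‖), norm_nonneg (f y), norm_nonneg (f' y)]

/-! ### Weighted sampling on the critical line with bounded local count -/

/-- **Weighted Bessel bound under a local-count hypothesis.** For a test function `h` supported
in `[-a, a]`, real sample points `γ_i` with weights `w_i ≥ 0` such that every window
`|γ_i - t| ≤ 1/2` carries total weight `≤ d`:
`∑_i w_i |ĥ(1/2 + iγ_i)|² ≤ d · π(3 + a²) · ‖h‖₂²` (Gallagher's cell inequality + Plancherel for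
`ĥ` and `(ixh)^`). [folklore] -/
theorem sum_mul_norm_sq_weilMellin_line_le_of_localCount {ι : Type*} (T : Finset ι) (γ : ι → ℝ)
    (w : ι → ℝ) (hw : ∀ i, 0 ≤ w i) {d : ℝ}
    (hd : ∀ t : ℝ, ∑ i ∈ T.filter (fun i ↦ |γ i - t| ≤ 1 / 2), w i ≤ d)
    {h : ℝ → ℂ} (hh : IsWeilTest h) {a : ℝ} (hha : tsupport h ⊆ Icc (-a) a) :
    ∑ i ∈ T, w i * ‖weilMellin h (1 / 2 + γ i * I)‖ ^ 2 ≤ d * (π * (3 + a ^ 2) * weilNorm2Sq h) := by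
  classical
  set f : ℝ → ℂ := fun v ↦ weilMellin h (1 / 2 + v * I) with hf_def
  set hI : ℝ → ℂ := fun x : ℝ ↦ I * x * h x with hhI_def
  have hhI : IsWeilTest hI := hh.I_mul
  set f' : ℝ → ℂ := fun v ↦ weilMellin hI (1 / 2 + v * I) with hf'_def
  have hder : ∀ v, HasDerivAt f (f' v) v := fun v ↦
    hasDerivAt_weilMellin_vertical hh.1.continuous hh.2 v
  have hfc : Continuous f := (continuous_weilMellin hh.1.continuous hh.2).comp (by fun_prop)
  have hf'c : Continuous f' := (continuous_weilMellin hhI.1.continuous hhI.2).comp (by fun_prop)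
  set φ : ℝ → ℝ := fun v ↦ 3 / 2 * ‖f v‖ ^ 2 + 1 / 2 * ‖f' v‖ ^ 2 with hφ_def
  have hφnn : ∀ v, 0 ≤ φ v := fun v ↦ by positivity
  have hif : Integrable fun v ↦ ‖f v‖ ^ 2 := integrable_norm_sq_weilMellin_half_line hh
  have hif' : Integrable fun v ↦ ‖f' v‖ ^ 2 := integrable_norm_sq_weilMellin_half_line hhI
  have hiφ : Integrable φ := (hif.const_mul _).add (hif'.const_mul _)
  have hd0 : 0 ≤ d := le_trans (Finset.sum_nonneg fun i _ ↦ hw i) (hd 0)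
  have h0 : 0 ≤ weilNorm2Sq h := integral_nonneg fun _ ↦ by positivity
  -- `∫ φ ≤ π (3 + a²) ‖h‖₂²`
  have hφint : ∫ v, φ v ≤ π * (3 + a ^ 2) * weilNorm2Sq h := by
    have e1 : ∫ v, ‖f v‖ ^ 2 = 2 * π * weilNorm2Sq h := integral_norm_sq_weilMellin_half_line hh
    have e2 : ∫ v, ‖f' v‖ ^ 2 = 2 * π * weilNorm2Sq hI := integral_norm_sq_weilMellin_half_line hhI
    have e3 : weilNorm2Sq hI ≤ a ^ 2 * weilNorm2Sq h := weilNorm2Sq_I_mul_le hh hha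
    rw [hφ_def, integral_add (hif.const_mul _) (hif'.const_mul _), MeasureTheory.integral_const_mul,
      MeasureTheory.integral_const_mul, e1, e2]
    nlinarith [Real.pi_pos]
  -- pointwise cell bound, written with indicators
  have hcell : ∀ i, ‖f (γ i)‖ ^ 2 ≤ ∫ v, (Ioc (γ i - 1 / 2) (γ i + 1 / 2)).indicator φ v := by
    intro i
    rw [MeasureTheory.integral_indicator measurableSet_Ioc, ← integral_of_le (by linarith)]
    exact norm_sq_le_integral_cell hder hf'c (γ i)
  have hii : ∀ i, Integrable fun v ↦ w i * (Ioc (γ i - 1 / 2) (γ i + 1 / 2)).indicator φ v :=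
    fun i ↦ (hiφ.indicator measurableSet_Ioc).const_mul _
  -- the local count, pointwise in `v`
  have hpt : ∀ v, ∑ i ∈ T, w i * (Ioc (γ i - 1 / 2) (γ i + 1 / 2)).indicator φ v ≤ d * φ v := by
    intro v
    have hsub : T.filter (fun i ↦ v ∈ Ioc (γ i - 1 / 2) (γ i + 1 / 2)) ⊆
        T.filter (fun i ↦ |γ i - v| ≤ 1 / 2) := by
      intro i hi
      simp only [Finset.mem_filter, mem_Ioc] at hi ⊢
      exact ⟨hi.1, abs_le.2 ⟨by linarith [hi.2.2], by linarith [hi.2.1]⟩⟩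
    have e : ∀ i ∈ T, w i * (Ioc (γ i - 1 / 2) (γ i + 1 / 2)).indicator φ v =
        if v ∈ Ioc (γ i - 1 / 2) (γ i + 1 / 2) then w i * φ v else 0 := by
      intro i _
      rw [Set.indicator_apply]
      split_ifs <;> simp
    rw [Finset.sum_congr rfl e, ← Finset.sum_filter, ← Finset.sum_mul]
    refine mul_le_mul_of_nonneg_right ?_ (hφnn v)
    exact (Finset.sum_le_sum_of_subset_of_nonneg hsub fun i _ _ ↦ hw i).trans (hd v)
  calc ∑ i ∈ T, w i * ‖f (γ i)‖ ^ 2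
      ≤ ∑ i ∈ T, w i * ∫ v, (Ioc (γ i - 1 / 2) (γ i + 1 / 2)).indicator φ v :=
        Finset.sum_le_sum fun i _ ↦ mul_le_mul_of_nonneg_left (hcell i) (hw i)
    _ = ∫ v, ∑ i ∈ T, w i * (Ioc (γ i - 1 / 2) (γ i + 1 / 2)).indicator φ v := by
        rw [integral_finsetSum _ fun i _ ↦ hii i]
        refine Finset.sum_congr rfl fun i _ ↦ ?_
        rw [MeasureTheory.integral_const_mul]
    _ ≤ ∫ v, d * φ v :=
        integral_mono (integrable_finsetSum _ fun i _ ↦ hii i) (hiφ.const_mul d) hpt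
    _ = d * ∫ v, φ v := MeasureTheory.integral_const_mul _ _
    _ ≤ d * (π * (3 + a ^ 2) * weilNorm2Sq h) := mul_le_mul_of_nonneg_left hφint hd0

/-! ### Real exponential tilts -/

/-- A real tilt shifts the transform: `(g(t) e^{σt})^(s) = ĝ(s + σ)`. [folklore] -/
theorem weilMellin_mul_cexp_real (g : ℝ → ℂ) (σ : ℝ) (s : ℂ) :
    weilMellin (fun t ↦ g t * cexp ((σ : ℂ) * t)) s = weilMellin g (s + σ) := by
  unfold weilMellin
  congr 1 with t
  rw [mul_assoc, ← Complex.exp_add]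
  congr 2
  ring

/-- Tilted tests are tests. [folklore] -/
theorem isWeilTest_mul_cexp_real (hg : IsWeilTest g) (σ : ℝ) :
    IsWeilTest fun t ↦ g t * cexp ((σ : ℂ) * t) := by
  refine ⟨hg.1.mul ?_, hg.2.mul_right⟩
  have h1 : ContDiff ℝ (⊤ : ℕ∞) fun t : ℝ ↦ (σ : ℂ) * (t : ℂ) :=
    contDiff_const.mul Complex.ofRealCLM.contDiff
  exact Complex.contDiff_exp.comp h1

/-- Support of a tilted test. [folklore] -/
theorem tsupport_mul_cexp_real_subset (g : ℝ → ℂ) (σ : ℝ) :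
    tsupport (fun t ↦ g t * cexp ((σ : ℂ) * t)) ⊆ tsupport g :=
  tsupport_mul_subset_left

/-- `‖g e^{σ·}‖₂² ≤ e^{2|σ|a} ‖g‖₂²` for `supp g ⊆ [-a, a]`. [folklore] -/
theorem weilNorm2Sq_mul_cexp_real_le (hg : IsWeilTest g) {a : ℝ} (hga : tsupport g ⊆ Icc (-a) a)
    (σ : ℝ) :
    weilNorm2Sq (fun t ↦ g t * cexp ((σ : ℂ) * t)) ≤ Real.exp (2 * |σ| * a) * weilNorm2Sq g := by
  unfold weilNorm2Sq
  rw [← MeasureTheory.integral_const_mul]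
  refine integral_mono (isWeilTest_mul_cexp_real hg σ).integrable_norm_sq
    (hg.integrable_norm_sq.const_mul _) fun t ↦ ?_
  by_cases ht : t ∈ tsupport g
  · have ht' := hga ht
    have habs : |t| ≤ a := abs_le.2 ⟨by linarith [ht'.1], ht'.2⟩
    rw [norm_mul, mul_pow, Complex.norm_exp, mul_comm]
    simp only [Complex.mul_re, Complex.ofReal_re, Complex.ofReal_im, zero_mul, sub_zero]
    refine mul_le_mul_of_nonneg_right ?_ (sq_nonneg _)
    rw [← Real.exp_nat_mul]
    refine Real.exp_le_exp.2 ?_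
    push_cast
    have : σ * t ≤ |σ| * a := by
      calc σ * t ≤ |σ * t| := le_abs_self _
        _ = |σ| * |t| := abs_mul _ _
        _ ≤ |σ| * a := mul_le_mul_of_nonneg_left habs (abs_nonneg _)
    linarith
  · simp [image_eq_zero_of_notMem_tsupport ht]

/-- `‖x g‖₂² ≤ a² ‖g‖₂²` for `supp g ⊆ [-a, a]`. [folklore] -/
theorem weilNorm2Sq_ofReal_mul_le (hg : IsWeilTest g) {a : ℝ} (hga : tsupport g ⊆ Icc (-a) a) :
    weilNorm2Sq (fun x : ℝ ↦ (x : ℂ) * g x) ≤ a ^ 2 * weilNorm2Sq g := by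
  have h := weilNorm2Sq_I_mul_le hg hga
  have e : weilNorm2Sq (fun x : ℝ ↦ I * x * g x) = weilNorm2Sq (fun x : ℝ ↦ (x : ℂ) * g x) := by
    unfold weilNorm2Sq
    congr 1 with x
    simp [mul_assoc]
  rwa [e] at h

/-! ### The `σ`-direction: a one-sided cell inside the strip -/

/-- The horizontal derivative of `ĝ`: `d/dσ ĝ(c + σ) = (x g)^(c + σ)`. [folklore] -/
theorem hasDerivAt_weilMellin_horizontal (hg : Continuous g) (hg' : HasCompactSupport g) (c : ℂ)
    (σ : ℝ) :
    HasDerivAt (fun σ : ℝ ↦ weilMellin g (c + σ))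
      (weilMellin (fun x : ℝ ↦ (x : ℂ) * g x) (c + σ)) σ := by
  have h1 : HasDerivAt (fun σ : ℝ ↦ c + (σ : ℂ)) 1 σ := by
    have := (hasDerivAt_id σ).ofReal_comp.const_add c
    simpa using this
  have h2 := (hasDerivAt_weilMellin hg hg' (c + σ)).comp σ h1
  rw [mul_one] at h2
  refine h2.congr_deriv ?_
  unfold weilMellin
  congr 1 with x
  ring

/-- **One-sided cell bound in the `σ`-direction.** For `Θ > 0`, `|β| ≤ Θ/2` and any `c`:
`‖ĝ(c + β)‖² ≤ (2/Θ) ∫_{-Θ/2}^{Θ/2} ‖ĝ(c+σ)‖² dσ + ∫_{-Θ/2}^{Θ/2} 2‖ĝ(c+σ)‖ ‖(xg)^(c+σ)‖ dσ`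
(Gallagher's one-sided inequality on the cell `[β - Θ/2, β]` or `[-Θ/2, 0]`, which stays inside
`[-Θ/2, Θ/2]`). [folklore] -/
theorem norm_sq_weilMellin_le_integral_sigma (hg : IsWeilTest g) (c : ℂ) {Θ β : ℝ} (hΘ : 0 < Θ)
    (hβ : |β| ≤ Θ / 2) :
    ‖weilMellin g (c + β)‖ ^ 2 ≤
      (2 / Θ) * (∫ σ in (-(Θ / 2))..(Θ / 2), ‖weilMellin g (c + σ)‖ ^ 2) +
        ∫ σ in (-(Θ / 2))..(Θ / 2),
          2 * (‖weilMellin g (c + σ)‖ * ‖weilMellin (fun x : ℝ ↦ (x : ℂ) * g x) (c + σ)‖) := by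
  set F : ℝ → ℂ := fun σ ↦ weilMellin g (c + σ) with hF
  set F' : ℝ → ℂ := fun σ ↦ weilMellin (fun x : ℝ ↦ (x : ℂ) * g x) (c + σ) with hF'
  have hxg : IsWeilTest fun x : ℝ ↦ (x : ℂ) * g x := hg.ofReal_mul
  have hder : ∀ σ, HasDerivAt F (F' σ) σ := fun σ ↦
    hasDerivAt_weilMellin_horizontal hg.1.continuous hg.2 c σ
  have hFc : Continuous F := (continuous_weilMellin hg.1.continuous hg.2).comp (by fun_prop)
  have hF'c : Continuous F' := (continuous_weilMellin hxg.1.continuous hxg.2).comp (by fun_prop)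
  -- the real function `G = ‖F‖²` and its derivative
  set G : ℝ → ℝ := fun σ ↦ ‖F σ‖ ^ 2 with hG
  set G' : ℝ → ℝ := fun σ ↦ 2 * inner ℝ (F σ) (F' σ) with hG'
  have hGd : ∀ σ, HasDerivAt G (G' σ) σ := fun σ ↦ (hder σ).norm_sq
  have hG'c : Continuous G' := continuous_const.mul (hFc.inner hF'c)
  have hG'le : ∀ σ, |G' σ| ≤ 2 * (‖F σ‖ * ‖F' σ‖) := by
    intro σ
    rw [hG', abs_mul, abs_two]
    exact mul_le_mul_of_nonneg_left (abs_real_inner_le_norm _ _) zero_le_two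
  -- the one-sided cell
  set α : ℝ := max (β - Θ / 2) (-(Θ / 2)) with hα
  have hαβ : α ≤ β := max_le (by linarith) (by linarith [(abs_le.1 hβ).1])
  have hβα : β ≤ α + Θ / 2 := by
    have : β - Θ / 2 ≤ α := le_max_left _ _
    linarith
  have hαl : -(Θ / 2) ≤ α := le_max_right _ _
  have hαu : α + Θ / 2 ≤ Θ / 2 := by
    have : α ≤ 0 := max_le (by linarith [(abs_le.1 hβ).2]) (by linarith)
    linarith
  have hL : 0 < Θ / 2 := by positivity
  have h := Gallagher.le_inv_mul_integral_add hGd hG'c hL hαβ hβα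
  -- enlarge both integrals to `[-Θ/2, Θ/2]`
  have hG0 : 0 ≤ᵐ[volume.restrict (Ioc (-(Θ / 2)) (Θ / 2))] G :=
    Eventually.of_forall fun _ ↦ by positivity
  have hA0 : 0 ≤ᵐ[volume.restrict (Ioc (-(Θ / 2)) (Θ / 2))] fun σ ↦ |G' σ| :=
    Eventually.of_forall fun _ ↦ abs_nonneg _
  have hGi : IntervalIntegrable G volume (-(Θ / 2)) (Θ / 2) := (hFc.norm.pow 2).intervalIntegrable _ _
  have hAi : IntervalIntegrable (fun σ ↦ |G' σ|) volume (-(Θ / 2)) (Θ / 2) :=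
    (continuous_abs.comp hG'c).intervalIntegrable _ _
  have h1 : ∫ σ in α..(α + Θ / 2), G σ ≤ ∫ σ in (-(Θ / 2))..(Θ / 2), G σ :=
    integral_mono_interval hαl (by linarith) hαu hG0 hGi
  have h2 : ∫ σ in α..(α + Θ / 2), |G' σ| ≤ ∫ σ in (-(Θ / 2))..(Θ / 2), |G' σ| :=
    integral_mono_interval hαl (by linarith) hαu hA0 hAi
  have h3 : ∫ σ in (-(Θ / 2))..(Θ / 2), |G' σ| ≤
      ∫ σ in (-(Θ / 2))..(Θ / 2), 2 * (‖F σ‖ * ‖F' σ‖) :=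
    intervalIntegral.integral_mono_on (by linarith) hAi
      ((continuous_const.mul (hFc.norm.mul hF'c.norm)).intervalIntegrable _ _) fun σ _ ↦ hG'le σ
  have hinv : (Θ / 2)⁻¹ = 2 / Θ := by rw [inv_div]
  rw [hinv] at h
  have h2Θ : 0 ≤ 2 / Θ := by positivity
  calc ‖weilMellin g (c + β)‖ ^ 2 = G β := rfl
    _ ≤ 2 / Θ * (∫ σ in α..(α + Θ / 2), G σ) + ∫ σ in α..(α + Θ / 2), |G' σ| := h
    _ ≤ 2 / Θ * (∫ σ in (-(Θ / 2))..(Θ / 2), G σ) +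
        ∫ σ in (-(Θ / 2))..(Θ / 2), 2 * (‖F σ‖ * ‖F' σ‖) := by
        gcongr
        exact h2.trans h3

end Summit.RiemannHypothesis.RiemannHypothesis.Theorems
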